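import Mathlib
import HarnessLib
import Literature.MathematicalPhysics.QuantumLattice.HubbardSchwingerFunctionBound
import Literature.MathematicalPhysics.QuantumLattice.MatsubaraSectorPropagator
import Literature.MathematicalPhysics.QuantumLattice.EnergyEntropyBalance

/-!
# The HIGH-FREQUENCY ASYMPTOTICS of thermal two-time correlations by Matsubara integration by parts (KMS sum rules):
# `|∫₀^β e^{ikτ}⟨A(τ)B⟩_β dτ + ⟨{A,B}⟩_β/(ik) − ⟨{[H,A],B}⟩_β/(ik)²| ≤ β‖[H,A]‖‖[H,B]‖/k²` at fermionic `k` (seat hubbard-kl-k3c5-p2, g2)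

Route `KLProgramme`, child 5 `KLRegimeVolumeLimitV11` (stmt-HubbardSuperconductivity-19826), clause (i) of the volume-limit text
`FinalTwoLegVolLimit` (the `(L, M)`-uniform bound on the two-leg vertex function at ALL Matsubara frequencies).  On the Hamiltonian side
(`M = ∞`) that bound is NOT engine-interior: it is an a-priori consequence, valid for EVERY coupling and uniform in the volume, of the
fermionic KMS boundary condition and two integrations by parts in the imaginary time.  This file proves the model-free core, for a Hermitian
matrix `H` (the Hamiltonian), arbitrary matrices `A`, `B` and the Gibbs state `⟨·⟩_β` of the tree (`Matrix.gibbsState`, `Matrix.imagTimeEvolve`,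
`A(τ) = e^{τH} A e^{-τH}`):

* §1 stationarity `⟨[H,Z]⟩_β = 0` (tree: `Matrix.gibbsState_commutator_eq_zero`), `imagTimeEvolve_comm` (`[H,A](τ) = [H, A(τ)]`) and the DERIVATIVE-MOVING identity
  `⟨[H,A](τ) B⟩_β = −⟨A(τ) [H,B]⟩_β` (`gibbsState_imagTimeEvolve_comm_mul`);
* §2 ONE integration by parts against `e^{ikτ}` with `e^{ikβ} = −1` (fermionic frequency; KMS `⟨A(β)B⟩ = ⟨BA⟩` supplies the boundary term):
  `∫₀^β e^{ikτ}⟨A(τ)B⟩dτ = −⟨AB + BA⟩/(ik) − (ik)⁻¹ ∫₀^β e^{ikτ}⟨[H,A](τ)B⟩dτ` (`fermionic_matsubara_ibp`);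
* §3 TWO steps and the Gibbs bound `|⟨X(τ)Y⟩_β| ≤ ‖X‖‖Y‖` (`norm_gibbsState_imagTimeEvolve_mul_le`, tree) on the remainder
  `−∫₀^β e^{ikτ}⟨[H,A](τ)[H,B]⟩dτ`:
  `‖∫₀^β e^{ikτ}⟨A(τ)B⟩dτ + ⟨AB+BA⟩/(ik) − ⟨[H,A]B + B[H,A]⟩/(ik)²‖ ≤ β·‖HA−AH‖·‖HB−BH‖/k²` (`norm_fermionic_matsubara_sub_sumRules_le`),
  and the crude bound `≤ β‖A‖‖B‖` (`norm_fermionic_matsubara_le`).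

For `A = c_{k⃗σ}`, `B = c†_{k⃗σ}` on the Hubbard torus (`{A,B} = 1`, `‖[H,c_{k⃗σ}]‖ ≤ |ε(k⃗) − μ| + |U|` uniformly in `L`) this is the statement
that the Matsubara Green function equals the free one up to `O((1 + β)/k₀²)` uniformly in the volume, i.e. that the re-amputated two-leg vertex
function (the carrier of `FinalTwoLegVolLimit`, `…VolumeLimitFrameReduction`) is bounded at all frequencies — for all `U`.  Standard (the
moments of the spectral function are equal-time (anti)commutators); everything here is proved, no definition, no citation needed beyond
Bratteli–Robinson II §5.3.1 for the KMS condition already in the tree.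
-/

noncomputable section

namespace Summit.HubbardSuperconductivity.HubbardSuperconductivity.Theorems.ThermalGreen

set_option linter.dupNamespace false -- summit = problem name (single-conjunct summit), D-0017

open scoped Matrix.Norms.L2Operator
open Matrix Complex MeasureTheory intervalIntegral Literature.MathematicalPhysics.QuantumLattice

variable {n : Type*} [Fintype n] [DecidableEq n]

/-! ## §1 Stationarity and moving the commutator -/

/-- The Hamiltonian is a fixed point of its own imaginary-time evolution: `H(s) = H`. -/
theorem imagTimeEvolve_self (H : Matrix n n ℂ) (s : ℂ) : imagTimeEvolve H s H = H := by
  have hc : H * NormedSpace.exp (-(s • H)) = NormedSpace.exp (-(s • H)) * H :=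
    ((((Commute.refl H).smul_right s).neg_right).exp_right).eq
  rw [imagTimeEvolve_eq, Matrix.mul_assoc, hc, ← Matrix.mul_assoc, Matrix.exp_smul_mul_exp_neg_smul, Matrix.one_mul]

/-- **The evolved commutator is the commutator of the evolved operator**: `[H,A](s) = H·A(s) − A(s)·H`. -/
theorem imagTimeEvolve_comm (H : Matrix n n ℂ) (s : ℂ) (A : Matrix n n ℂ) :
    imagTimeEvolve H s (H * A - A * H) = H * imagTimeEvolve H s A - imagTimeEvolve H s A * H := by
  have h1 : imagTimeEvolve H s (H * A) = H * imagTimeEvolve H s A := by rw [imagTimeEvolve_mul, imagTimeEvolve_self]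
  have h2 : imagTimeEvolve H s (A * H) = imagTimeEvolve H s A * H := by rw [imagTimeEvolve_mul, imagTimeEvolve_self]
  have hsub : H * A - A * H = H * A + (-1 : ℂ) • (A * H) := by rw [neg_one_smul, sub_eq_add_neg]
  rw [hsub, imagTimeEvolve_add_op, imagTimeEvolve_smul, h1, h2, neg_one_smul, ← sub_eq_add_neg]

/-- **Moving the commutator across the state**: `⟨[H,A](s)·B⟩_β = −⟨A(s)·[H,B]⟩_β` (stationarity applied to `Z = A(s)B`). -/
theorem gibbsState_imagTimeEvolve_comm_mul (β : ℝ) (H A B : Matrix n n ℂ) (s : ℂ) :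
    gibbsState β H (imagTimeEvolve H s (H * A - A * H) * B) = -gibbsState β H (imagTimeEvolve H s A * (H * B - B * H)) := by
  have h0 := Matrix.gibbsState_commutator_eq_zero β H (imagTimeEvolve H s A * B)
  rw [imagTimeEvolve_comm, eq_neg_iff_add_eq_zero, ← map_add, ← h0]
  congr 1
  noncomm_ring

/-! ## §2 One fermionic integration by parts -/

/-- **The tree's fermionic frequencies qualify**: `e^{i k₀ β} = −1` for `k₀ = fermiMatsubara β m = (2m+1)π/β`, `β ≠ 0`. -/
theorem cexp_fermiMatsubara_mul_beta {β : ℝ} (hβ : β ≠ 0) (m : ℤ) : cexp (I * (fermiMatsubara β m : ℝ) * β) = -1 := by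
  have hβc : (β : ℂ) ≠ 0 := by exact_mod_cast hβ
  have h : (I * ((fermiMatsubara β m : ℝ) : ℂ) * (β : ℂ)) = ((2 * m + 1 : ℤ) : ℂ) * ((Real.pi : ℂ) * I) := by
    rw [fermiMatsubara]; push_cast; field_simp
  rw [h, Complex.exp_int_mul, Complex.exp_pi_mul_I]
  exact Odd.neg_one_zpow ⟨m, rfl⟩

/-- A fermionic frequency is non-zero: `e^{ikβ} = −1 ⇒ k ≠ 0`. -/
theorem ne_zero_of_cexp_eq_neg_one {k β : ℝ} (hk : cexp (I * k * β) = -1) : k ≠ 0 := by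
  rintro rfl
  norm_num at hk

/-- **ONE MATSUBARA INTEGRATION BY PARTS.**  For a fermionic frequency `k` (`e^{ikβ} = −1`):
`∫₀^β e^{ikτ}⟨A(τ)B⟩_β dτ = −⟨AB + BA⟩_β/(ik) − (ik)⁻¹·∫₀^β e^{ikτ}⟨[H,A](τ)B⟩_β dτ`
(boundary terms by KMS, `⟨A(β)B⟩_β = ⟨BA⟩_β`; derivative `d/dτ⟨A(τ)B⟩ = ⟨[H,A](τ)B⟩`). -/
theorem fermionic_matsubara_ibp (β : ℝ) (H A B : Matrix n n ℂ) {k : ℝ} (hk : cexp (I * k * β) = -1) :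
    ∫ τ in (0 : ℝ)..β, cexp (I * k * τ) * gibbsState β H (imagTimeEvolve H (τ : ℂ) A * B) =
      -(gibbsState β H (A * B + B * A)) / (I * k) -
        (I * k)⁻¹ * ∫ τ in (0 : ℝ)..β, cexp (I * k * τ) * gibbsState β H (imagTimeEvolve H (τ : ℂ) (H * A - A * H) * B) := by
  have hkc : (k : ℂ) ≠ 0 := by exact_mod_cast ne_zero_of_cexp_eq_neg_one hk
  have hk0 : (I * k : ℂ) ≠ 0 := mul_ne_zero I_ne_zero hkc
  set u : ℝ → ℂ := fun t => gibbsState β H (imagTimeEvolve H (t : ℂ) A * B) with hu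
  set u' : ℝ → ℂ := fun t => gibbsState β H (imagTimeEvolve H (t : ℂ) (H * A - A * H) * B) with hu'
  set v : ℝ → ℂ := fun t => cexp (I * k * t) / (I * k) with hv
  set v' : ℝ → ℂ := fun t => cexp (I * k * t) with hv'
  have hdu : ∀ t : ℝ, HasDerivAt u (u' t) t := fun t => hasDerivAt_gibbsState_imagTimeEvolve_mul β H A B t
  have hdv : ∀ t : ℝ, HasDerivAt v (v' t) t := by
    intro t
    have hc : HasDerivAt (fun z : ℂ => cexp (I * k * z) / (I * k)) (cexp (I * k * (t : ℂ)) * (I * k * 1) / (I * k)) (t : ℂ) :=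
      (((hasDerivAt_id (t : ℂ)).const_mul (I * k)).cexp).div_const (I * k)
    have hval : cexp (I * k * (t : ℂ)) * (I * k * 1) / (I * k) = cexp (I * k * (t : ℂ)) := by field_simp
    rw [hval] at hc
    exact hc.comp_ofReal
  have hcu' : Continuous u' := continuous_gibbsState_imagTimeEvolve_mul β H (H * A - A * H) B
  have hcv' : Continuous v' := by
    rw [hv']
    exact Complex.continuous_exp.comp (continuous_const.mul Complex.continuous_ofReal)
  have hibp := intervalIntegral.integral_mul_deriv_eq_deriv_mul (a := (0 : ℝ)) (b := β) (fun t _ => hdu t) (fun t _ => hdv t)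
    (hcu'.intervalIntegrable _ _) (hcv'.intervalIntegrable _ _)
  -- `∫ e^{ikτ} u = ∫ u v'`
  have hlhs : ∫ τ in (0 : ℝ)..β, cexp (I * k * τ) * u τ = ∫ τ in (0 : ℝ)..β, u τ * v' τ := by
    refine intervalIntegral.integral_congr fun t _ => ?_
    rw [hv']; dsimp only; rw [mul_comm]
  have hrhs : ∫ τ in (0 : ℝ)..β, u' τ * v τ = (I * k)⁻¹ * ∫ τ in (0 : ℝ)..β, cexp (I * k * τ) * u' τ := by
    rw [← intervalIntegral.integral_const_mul]
    refine intervalIntegral.integral_congr fun t _ => ?_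
    rw [hv]; dsimp only; rw [div_eq_mul_inv]; ring
  -- boundary values
  have huβ : u β = gibbsState β H (B * A) := by
    rw [hu]; dsimp only; rw [← gibbsState_mul_eq_gibbsState_imagTimeEvolve_mul]
  have hu0 : u 0 = gibbsState β H (A * B) := by rw [hu]; dsimp only; rw [Complex.ofReal_zero, imagTimeEvolve_zero]
  have hvβ : v β = -1 / (I * k) := by rw [hv]; dsimp only; rw [hk]
  have hv0 : v 0 = 1 / (I * k) := by rw [hv]; dsimp only; rw [Complex.ofReal_zero, mul_zero, Complex.exp_zero]
  change ∫ τ in (0 : ℝ)..β, cexp (I * k * τ) * u τ = -(gibbsState β H (A * B + B * A)) / (I * k) -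
    (I * k)⁻¹ * ∫ τ in (0 : ℝ)..β, cexp (I * k * τ) * u' τ
  rw [hlhs, hibp, hrhs, huβ, hu0, hvβ, hv0, map_add]
  field_simp
  ring

/-! ## §3 Two steps: the sum-rule asymptotics with an explicit remainder -/

/-- **The remainder of the second step is a two-commutator correlation**:
`∫₀^β e^{ikτ}⟨[H,[H,A]](τ)B⟩dτ = −∫₀^β e^{ikτ}⟨[H,A](τ)[H,B]⟩dτ`. -/
theorem integral_doubleComm_eq_neg (β : ℝ) (H A B : Matrix n n ℂ) (k : ℝ) :
    ∫ τ in (0 : ℝ)..β, cexp (I * k * τ) * gibbsState β H (imagTimeEvolve H (τ : ℂ) (H * (H * A - A * H) - (H * A - A * H) * H) * B) =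
      -∫ τ in (0 : ℝ)..β, cexp (I * k * τ) * gibbsState β H (imagTimeEvolve H (τ : ℂ) (H * A - A * H) * (H * B - B * H)) := by
  rw [← intervalIntegral.integral_neg]
  refine intervalIntegral.integral_congr fun t _ => ?_
  rw [gibbsState_imagTimeEvolve_comm_mul, mul_neg]

/-- **The Gibbs bound on a Matsubara transform**: `‖∫₀^β e^{ikτ}⟨X(τ)Y⟩_β dτ‖ ≤ β‖X‖‖Y‖` (Hermitian `H`, `0 ≤ β`). -/
theorem norm_fermionic_matsubara_le {H : Matrix n n ℂ} (hH : H.IsHermitian) [Nonempty n] {β : ℝ} (hβ : 0 ≤ β)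
    (X Y : Matrix n n ℂ) (k : ℝ) :
    ‖∫ τ in (0 : ℝ)..β, cexp (I * k * τ) * gibbsState β H (imagTimeEvolve H (τ : ℂ) X * Y)‖ ≤ β * (‖X‖ * ‖Y‖) := by
  have h := intervalIntegral.norm_integral_le_of_norm_le_const (a := (0 : ℝ)) (b := β) (C := ‖X‖ * ‖Y‖)
    (f := fun τ : ℝ => cexp (I * k * τ) * gibbsState β H (imagTimeEvolve H (τ : ℂ) X * Y)) ?_
  · rw [sub_zero, abs_of_nonneg hβ] at h
    linarith
  · intro t ht
    rw [Set.uIoc_of_le hβ] at ht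
    have hexp : ‖cexp (I * k * t)‖ = 1 := by
      rw [show (I * k * t : ℂ) = ((k * t : ℝ) : ℂ) * I by push_cast; ring, Complex.norm_exp_ofReal_mul_I]
    rw [norm_mul, hexp, one_mul]
    exact norm_gibbsState_imagTimeEvolve_mul_le hH ht.1.le ht.2 X Y

/-- **HIGH-FREQUENCY ASYMPTOTICS OF A FERMIONIC MATSUBARA TRANSFORM (two sum rules and a remainder).**  For Hermitian `H`, `0 ≤ β`, any
`A`, `B` and a fermionic frequency `k` (`e^{ikβ} = −1`):
`‖∫₀^β e^{ikτ}⟨A(τ)B⟩_β dτ + ⟨AB+BA⟩_β/(ik) − ⟨[H,A]B + B[H,A]⟩_β/(ik)²‖ ≤ β·‖HA − AH‖·‖HB − BH‖/k²`.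
The volume enters only through the commutators of `A` and `B` with `H`. -/
theorem norm_fermionic_matsubara_sub_sumRules_le {H : Matrix n n ℂ} (hH : H.IsHermitian) [Nonempty n] {β : ℝ} (hβ : 0 ≤ β)
    (A B : Matrix n n ℂ) {k : ℝ} (hk : cexp (I * k * β) = -1) :
    ‖(∫ τ in (0 : ℝ)..β, cexp (I * k * τ) * gibbsState β H (imagTimeEvolve H (τ : ℂ) A * B)) +
        gibbsState β H (A * B + B * A) / (I * k) -
          gibbsState β H ((H * A - A * H) * B + B * (H * A - A * H)) / (I * k) ^ 2‖ ≤
      β * (‖H * A - A * H‖ * ‖H * B - B * H‖) / k ^ 2 := by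
  have hkr : k ≠ 0 := ne_zero_of_cexp_eq_neg_one hk
  have hk0 : (I * k : ℂ) ≠ 0 := mul_ne_zero I_ne_zero (by exact_mod_cast hkr)
  set C : Matrix n n ℂ := H * A - A * H with hC
  set G₂ : ℂ := ∫ τ in (0 : ℝ)..β, cexp (I * k * τ) * gibbsState β H (imagTimeEvolve H (τ : ℂ) C * (H * B - B * H)) with hG₂
  have h1 := fermionic_matsubara_ibp β H A B hk
  have h2 := fermionic_matsubara_ibp β H C B hk
  rw [← hC] at h1
  rw [integral_doubleComm_eq_neg, ← hC, ← hG₂] at h2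
  have hid : (∫ τ in (0 : ℝ)..β, cexp (I * k * τ) * gibbsState β H (imagTimeEvolve H (τ : ℂ) A * B)) +
        gibbsState β H (A * B + B * A) / (I * k) - gibbsState β H (C * B + B * C) / (I * k) ^ 2 = -G₂ / (I * k) ^ 2 := by
    rw [h1, h2]
    field_simp
    ring
  rw [hid, norm_div, norm_neg, norm_pow, norm_mul, Complex.norm_I, one_mul, Complex.norm_real, Real.norm_eq_abs, sq_abs]
  exact div_le_div_of_nonneg_right (norm_fermionic_matsubara_le hH hβ C (H * B - B * H) k) (sq_nonneg k)

/-- **The same, as an asymptotic bound on the transform itself**: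
`‖∫₀^β e^{ikτ}⟨A(τ)B⟩_β dτ‖ ≤ ‖⟨AB+BA⟩_β‖/|k| + ‖⟨[H,A]B + B[H,A]⟩_β‖/k² + β‖HA−AH‖‖HB−BH‖/k²`. -/
theorem norm_fermionic_matsubara_le_of_sumRules {H : Matrix n n ℂ} (hH : H.IsHermitian) [Nonempty n] {β : ℝ} (hβ : 0 ≤ β)
    (A B : Matrix n n ℂ) {k : ℝ} (hk : cexp (I * k * β) = -1) :
    ‖∫ τ in (0 : ℝ)..β, cexp (I * k * τ) * gibbsState β H (imagTimeEvolve H (τ : ℂ) A * B)‖ ≤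
      ‖gibbsState β H (A * B + B * A)‖ / |k| + ‖gibbsState β H ((H * A - A * H) * B + B * (H * A - A * H))‖ / k ^ 2 +
        β * (‖H * A - A * H‖ * ‖H * B - B * H‖) / k ^ 2 := by
  have hkr : k ≠ 0 := ne_zero_of_cexp_eq_neg_one hk
  have h := norm_fermionic_matsubara_sub_sumRules_le hH hβ A B hk
  set G : ℂ := ∫ τ in (0 : ℝ)..β, cexp (I * k * τ) * gibbsState β H (imagTimeEvolve H (τ : ℂ) A * B) with hG
  set a : ℂ := gibbsState β H (A * B + B * A) / (I * k) with ha
  set b : ℂ := gibbsState β H ((H * A - A * H) * B + B * (H * A - A * H)) / (I * k) ^ 2 with hb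
  have hna : ‖a‖ = ‖gibbsState β H (A * B + B * A)‖ / |k| := by
    rw [ha, norm_div, norm_mul, Complex.norm_I, one_mul, Complex.norm_real, Real.norm_eq_abs]
  have hnb : ‖b‖ = ‖gibbsState β H ((H * A - A * H) * B + B * (H * A - A * H))‖ / k ^ 2 := by
    rw [hb, norm_div, norm_pow, norm_mul, Complex.norm_I, one_mul, Complex.norm_real, Real.norm_eq_abs, sq_abs]
  calc ‖G‖ = ‖(G + a - b) - a + b‖ := by ring_nf
    _ ≤ ‖G + a - b‖ + ‖a‖ + ‖b‖ := by
        calc ‖(G + a - b) - a + b‖ ≤ ‖(G + a - b) - a‖ + ‖b‖ := norm_add_le _ _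
          _ ≤ ‖G + a - b‖ + ‖a‖ + ‖b‖ := by gcongr; exact norm_sub_le _ _
    _ ≤ β * (‖H * A - A * H‖ * ‖H * B - B * H‖) / k ^ 2 + ‖gibbsState β H (A * B + B * A)‖ / |k| +
          ‖gibbsState β H ((H * A - A * H) * B + B * (H * A - A * H))‖ / k ^ 2 := by rw [← hna, ← hnb]; gcongr
    _ = _ := by ring

end Summit.HubbardSuperconductivity.HubbardSuperconductivity.Theorems.ThermalGreen

end
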